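import Summits.QuantumAdvantage.QuantumAdvantage.Theses.CharDial
import Summits.QuantumAdvantage.QuantumAdvantage.Theorems.CharDialTopZeroBounded
import Summits.QuantumAdvantage.QuantumAdvantage.Theorems.CharDialExchangeBridge
import Summits.QuantumAdvantage.QuantumAdvantage.Theorems.CharDialMultiRamsey
import HarnessLib

/-!
# CharDialIslandDialA — TREE PART A of the decomp-qadv lens-5 g28 node «IslandDial» (defs · finite range · bridge · `closes` BY NAME ·
# necessity of piece I · TABLE EQUIV layer · decided continent rungs).  Part B (`CharDialIslandDialB`) = necessity of piece E + exactness.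
Node file with ONLY the namespace renamed `Theses.IslandDial → Theorems.IslandDial` and cut in two at the `NecessityE` section (≤ 400-line lint).
-/


/-!
# IslandDial — decomp-qadv-lens-5 g28 node on `CharDial.FrobStructureLawOdd` (stmt-QuantumAdvantage-27205)

Lens 5 «finite/base range + asymptotic regime + bridge» applied to the open LAW-BET leaf of route CharDial:
T = `FrobStructureLawOdd` (every Boolean `f` of `𝔽_p`-degree `≤ p − 1`, `p ≥ 5`, is `h(u|_J, Σ aᵢuᵢ)` with `|J| ≤ J₀(p)`).

DIAL = the number of RELEVANT variables of `f` against the Ramsey threshold `N(p)`: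
* FINITE RANGE (`< N(p)` relevant variables): `f` is an `N(p)`-junta — the normal form with `a = 0` (kernel, trivial);
* ASYMPTOTIC REGIME (`≥ N(p)` relevant variables): hypergraph Ramsey (tree `SubChar.ramsey_finite_colours`) on the
  colouring `T ↦ μ_T(1_f)` of the `(p−1)`-subsets of the relevant set gives a large block `X` with CONSTANT top layer `γ`;
  `γ = 0` is impossible (tree `SubChar.topZero_bounded`, all primes); `γ ≠ 0` is handed to the two pieces below;
* BRIDGE = the kernel composition `closes` (lens-6 g8's p = 5 skeleton `Law25p5.skeleton.frobStructureLaw_five_of`,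
  here typed and proved UNIFORMLY in `p` and concluding the live decl BY NAME).

PIECES (both typed `∀ p ≥ 5`, both NECESSARY — `islandOdd_of_target`, `exchCoreOdd_of_target` — so the split is EXACT):
* `ExchCoreOdd` («constant non-zero top layer ⟹ co-bounded exchangeability»): if all `μ_T(1_f)`, `T ⊆ X`, `|T| = p−1`,
  equal one `γ ≠ 0`, then all but `E(p)` coordinates of `X` are pairwise exchangeable for `f`.
* `IslandOdd` («one island ⟹ normal form», ISLAND-ALG): `≥ p` relevant pairwise exchangeable coordinates force the
  normal form of T with an absolutely bounded junta.
`closes : ExchCoreOdd → IslandOdd → CharDial.FrobStructureLawOdd`.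
-/

set_option autoImplicit false
set_option linter.dupNamespace false


namespace Summit.QuantumAdvantage.QuantumAdvantage.Theorems.IslandDial

open Finset
open Summit.QuantumAdvantage.AdviceFreeQNC0
open Literature.Computability.MetaComplexity Literature.Computability.MetaComplexity.Smolensky

/-- Coordinate `i` is RELEVANT for `f`. -/
def Relevant {n : ℕ} (f : (Fin n → Bool) → Bool) (i : Fin n) : Prop :=
  ∃ (u : Fin n → Bool) (b : Bool), f (Function.update u i b) ≠ f u

/-- The coordinates of `Y` are pairwise EXCHANGEABLE for `f` (`f` is invariant under every transposition inside `Y`). -/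
def Exch {n : ℕ} (f : (Fin n → Bool) → Bool) (Y : Finset (Fin n)) : Prop :=
  ∀ i ∈ Y, ∀ j ∈ Y, ∀ u : Fin n → Bool, f (u ∘ Equiv.swap i j) = f u

/-- The NORMAL FORM of law 2½ with junta bound `J₀`: `f u = h(u|_J, Σᵢ [uᵢ] aᵢ)`, `|J| ≤ J₀` (verbatim the matrix of
`CharDial.FrobStructureLawOdd`). -/
def NormalForm (p : ℕ) {n : ℕ} (f : (Fin n → Bool) → Bool) (J₀ : ℕ) : Prop :=
  ∃ J : Finset (Fin n), J.card ≤ J₀ ∧ ∃ a : Fin n → ZMod p, ∃ h : (Fin n → Bool) → ZMod p → Bool,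
    (∀ u v : Fin n → Bool, (∀ i ∈ J, u i = v i) → ∀ s, h u s = h v s) ∧ ∀ u, f u = h u (∑ i, if u i then a i else 0)

/-- The top layer of `f` on `X` is the constant `γ`: every Möbius coefficient `μ_T(1_f)`, `T ⊆ X`, `|T| = p − 1`, equals `γ`. -/
def TopConst (p : ℕ) {n : ℕ} (f : (Fin n → Bool) → Bool) (X : Finset (Fin n)) (γ : ZMod p) : Prop :=
  ∀ T ⊆ X, T.card = p - 1 → SubLog.moeb (SubLog.indR (ZMod p) f) T = γ

/-! ### Piece E — exchangeable core under a constant non-zero top layer -/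

/-- `ExchCoreAt p`: constant NON-ZERO top layer on `X` ⟹ all but `E` coordinates of `X` are pairwise exchangeable. -/
def ExchCoreAt (p : ℕ) [Fact p.Prime] : Prop :=
  ∃ E : ℕ, ∀ (n : ℕ) (f : (Fin n → Bool) → Bool) (X : Finset (Fin n)), HasDegF p f (p - 1) →
    (∃ γ : ZMod p, γ ≠ 0 ∧ TopConst p f X γ) →
    ∃ Y : Finset (Fin n), Y ⊆ X ∧ X.card ≤ Y.card + E ∧ Exch f Y

/-- Piece E of the node, typed over the odd primes `p ≥ 5` of the target. -/
def ExchCoreOdd : Prop := ∀ (p : ℕ) [Fact p.Prime], 5 ≤ p → ExchCoreAt p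

/-! ### Piece I — one island forces the normal form (ISLAND-ALG) -/

/-- `IslandAt p`: `≥ p` relevant, pairwise exchangeable coordinates ⟹ the normal form with an absolute junta bound. -/
def IslandAt (p : ℕ) [Fact p.Prime] : Prop :=
  ∃ J₁ : ℕ, ∀ (n : ℕ) (f : (Fin n → Bool) → Bool) (Y : Finset (Fin n)), HasDegF p f (p - 1) → p ≤ Y.card →
    (∀ i ∈ Y, Relevant f i) → Exch f Y → NormalForm p f J₁

/-- Piece I of the node, typed over the odd primes `p ≥ 5` of the target. -/
def IslandOdd : Prop := ∀ (p : ℕ) [Fact p.Prime], 5 ≤ p → IslandAt p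

/-! ### The bridge: Ramsey + zero-top-layer impossibility (tree) + the two pieces ⟹ the law at `p` -/

/-- FINITE RANGE: a function all of whose relevant coordinates lie in `V` has the normal form with junta `V` and `a = 0`. -/
theorem normalForm_of_few_relevant (p : ℕ) {n : ℕ} (f : (Fin n → Bool) → Bool) (V : Finset (Fin n))
    (hV : ∀ i, i ∉ V → ¬ Relevant f i) : NormalForm p f V.card := by
  classical
  have hirr : ∀ u, ∀ k ∈ Finset.univ \ V, ∀ b, f (Function.update u k b) = f u := by
    intro u k hk b
    by_contra hne
    exact hV k (Finset.mem_sdiff.1 hk).2 ⟨u, b, hne⟩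
  refine ⟨V, le_rfl, 0, fun u _ => f (fun i => if i ∈ V then u i else false), ?_, ?_⟩
  · intro u v huv s
    show f (fun i => if i ∈ V then u i else false) = f (fun i => if i ∈ V then v i else false)
    congr 1
    funext i
    by_cases hi : i ∈ V
    · rw [if_pos hi, if_pos hi, huv i hi]
    · rw [if_neg hi, if_neg hi]
  · intro u
    show f u = f (fun i => if i ∈ V then u i else false)
    refine SubChar.agree_of_irrelevant f (Finset.univ \ V) hirr u _ (fun k hk => ?_)
    have hkV : k ∈ V := by
      by_contra h
      exact hk (Finset.mem_sdiff.2 ⟨Finset.mem_univ _, h⟩)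
    rw [if_pos hkV]

/-- THE LAW AT ONE PRIME from the two pieces (uniform-in-`p` form of lens-6 g8's `frobStructureLaw_five_of`). -/
theorem lawAt_of_pieces (p : ℕ) [hp : Fact p.Prime] (hE : ExchCoreAt p) (hI : IslandAt p) :
    ∃ J₀ : ℕ, ∀ (n : ℕ) (f : (Fin n → Bool) → Bool), HasDegF p f (p - 1) → NormalForm p f J₀ := by
  classical
  obtain ⟨M₀, hM₀⟩ := SubChar.topZero_bounded p
  obtain ⟨E, hE⟩ := hE
  obtain ⟨J₁, hJ₁⟩ := hI
  obtain ⟨N, hN⟩ := SubChar.ramsey_finite_colours (ZMod p) (p - 1) (max (M₀ + 1) (E + p))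
  refine ⟨max N J₁, fun n f hf => ?_⟩
  set V : Finset (Fin n) := Finset.univ.filter fun i => Relevant f i with hVdef
  by_cases hV : N ≤ V.card
  · -- ASYMPTOTIC REGIME: Ramsey block with constant top layer
    obtain ⟨X, hXV, hMX, γ, hγ⟩ := hN (Fin n) V hV (fun T => SubLog.moeb (SubLog.indR (ZMod p) f) T)
    have hXrel : ∀ i ∈ X, Relevant f i := fun i hi => (Finset.mem_filter.1 (hXV hi)).2
    by_cases hγ0 : γ = 0
    · exfalso
      have hle := hM₀ n f X hf hXrel (fun T hT hc => by rw [hγ T hT hc, hγ0])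
      have h1 : M₀ + 1 ≤ X.card := le_trans (le_max_left _ _) hMX
      omega
    · obtain ⟨Y, hYX, hcard, hex⟩ := hE n f X hf ⟨γ, hγ0, hγ⟩
      have h2 : E + p ≤ X.card := le_trans (le_max_right _ _) hMX
      have hYp : p ≤ Y.card := by omega
      obtain ⟨J, hJ, a, h, hh, hf'⟩ := hJ₁ n f Y hf hYp (fun i hi => hXrel i (hYX hi)) hex
      exact ⟨J, le_trans hJ (le_max_right _ _), a, h, hh, hf'⟩
  · -- FINITE RANGE: fewer than `N` relevant coordinates
    have hVN : V.card ≤ N := le_of_lt (not_le.1 hV)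
    obtain ⟨J, hJ, a, h, hh, hf'⟩ := normalForm_of_few_relevant p f V
      (fun i hi hrel => hi (Finset.mem_filter.2 ⟨Finset.mem_univ _, hrel⟩))
    exact ⟨J, le_trans hJ (le_trans hVN (le_max_left _ _)), a, h, hh, hf'⟩

/-- **`closes`** — the node's junction onto the live item BY NAME:
`ExchCoreOdd → IslandOdd → CharDial.FrobStructureLawOdd` (stmt-QuantumAdvantage-27205). -/
theorem closes (hE : ExchCoreOdd) (hI : IslandOdd) :
    Summit.QuantumAdvantage.QuantumAdvantage.Theses.CharDial.FrobStructureLawOdd := by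
  intro p _ hp
  obtain ⟨J₀, hJ₀⟩ := lawAt_of_pieces p (hE p hp) (hI p hp)
  exact ⟨J₀, fun n f hf => hJ₀ n f hf⟩

/-! ### Necessity: both pieces follow from the target (the split is exact) -/

/-- T ⟹ piece I (an island is a special case). -/
theorem islandOdd_of_target (hT : Summit.QuantumAdvantage.QuantumAdvantage.Theses.CharDial.FrobStructureLawOdd) :
    IslandOdd := by
  intro p _ hp
  obtain ⟨J₀, hJ₀⟩ := hT p hp
  exact ⟨J₀, fun n f Y hf _ _ _ => hJ₀ n f hf⟩



/-! ### One EQUIV layer under piece I: the TABLE form (lens-6 g8 `Law25.stub_table`, typed for every `p`)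

An island `Y` enters `f` only through `wt_Y mod p` (HYBRID m = 1, kernel for all primes from `SubChar.jBlock_frob`), so
piece I is EQUIVALENT to a statement about tables `H : {0,1}^{Yᶜ} × 𝔽_p → {0,1}` — the ISLAND-ALG of PLAN-g9 §3
(paper-complete at `p = 5`, first open cell `(p, κ) = (7, 3)`); this is the finite-range face of the piece. -/

section Table

variable {p : ℕ} [hp : Fact p.Prime] {n : ℕ}

/-- `TableAt p` (= lens-6's `stub_table` with `5 ↦ p`): a degree-`≤ p − 1` function of the shape `H(u|_{Yᶜ}, wt_Y mod p)`
with `Y` relevant and `|Y| ≥ p` has the normal form with an absolute junta bound. -/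
def TableAt (p : ℕ) [Fact p.Prime] : Prop :=
  ∃ J₁ : ℕ, ∀ (n : ℕ) (f : (Fin n → Bool) → Bool) (H : (Fin n → Bool) → ZMod p → Bool) (Y : Finset (Fin n)),
    (∀ u, f u = H (JLin.proj (Finset.univ \ Y) u) (SubChar.bw Y u : ZMod p)) → HasDegF p f (p - 1) → p ≤ Y.card →
    (∀ i ∈ Y, Relevant f i) → NormalForm p f J₁

/-- HYBRID at `m = 1` (all primes; lens-6 g8 `Law25.exch_weight_form`, re-proved here from the tree's `jBlock_frob`):
`≥ p − 1` pairwise exchangeable coordinates enter only through their weight mod `p`. -/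
theorem exch_weight_form (p : ℕ) [Fact p.Prime] (f : (Fin n → Bool) → Bool) (Y : Finset (Fin n))
    (hf : HasDegF p f (p - 1)) (hY : p - 1 ≤ Y.card) (hex : Exch f Y) :
    ∃ H : (Fin n → Bool) → ZMod p → Bool, ∀ u, f u = H (JLin.proj (Finset.univ \ Y) u) (SubChar.bw Y u : ZMod p) := by
  classical
  obtain ⟨a, h, hh⟩ := SubChar.jBlock_frob p (m := 1) (fun _ => Y)
    (fun j k hjk => absurd (Subsingleton.elim j k) hjk) (fun _ => hY) (Finset.univ \ Y)
    (fun _ => disjoint_sdiff_self_left) f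
    (fun u v hJ hbw => SubChar.symm_of_swap_invariant f (fun u i hi j hj => hex i hi j hj u) u v
      (fun k hk => hJ k (Finset.mem_sdiff.2 ⟨Finset.mem_univ _, hk⟩)) (hbw 0)) hf
  refine ⟨fun z s => h z (a 0 * s), fun u => ?_⟩
  rw [hh u]
  simp [SubChar.blin]

/-- A function of `(u|_{Yᶜ}, wt_Y)` is exchangeable on `Y`. -/
theorem exch_of_weight_form {f : (Fin n → Bool) → Bool} {H : (Fin n → Bool) → ZMod p → Bool} {Y : Finset (Fin n)}
    (hH : ∀ u, f u = H (JLin.proj (Finset.univ \ Y) u) (SubChar.bw Y u : ZMod p)) : Exch f Y := by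
  classical
  intro i hi j hj u
  have hproj : JLin.proj (Finset.univ \ Y) (u ∘ Equiv.swap i j) = JLin.proj (Finset.univ \ Y) u := by
    funext k
    unfold JLin.proj
    by_cases hk : k ∈ Finset.univ \ Y
    · rw [if_pos hk, if_pos hk]
      have hkY : k ∉ Y := (Finset.mem_sdiff.1 hk).2
      have hki : k ≠ i := fun e => hkY (e ▸ hi)
      have hkj : k ≠ j := fun e => hkY (e ▸ hj)
      show u (Equiv.swap i j k) = u k
      rw [Equiv.swap_apply_of_ne_of_ne hki hkj]
    · rw [if_neg hk, if_neg hk]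
  rw [hH, hH, hproj, SubChar.bw_comp_swap hi hj]

/-- **Piece I ⟺ its table form** (the EQUIV layer is honest: both directions kernel). -/
theorem islandAt_iff_tableAt (p : ℕ) [Fact p.Prime] : IslandAt p ↔ TableAt p := by
  constructor
  · rintro ⟨J₁, hJ₁⟩
    exact ⟨J₁, fun n f H Y hH hf hY hrel => hJ₁ n f Y hf hY hrel (exch_of_weight_form hH)⟩
  · rintro ⟨J₁, hJ₁⟩
    refine ⟨J₁, fun n f Y hf hY hrel hex => ?_⟩
    have hp1 : p - 1 ≤ Y.card := le_trans (Nat.sub_le p 1) hY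
    obtain ⟨H, hH⟩ := exch_weight_form p f Y hf hp1 hex
    exact hJ₁ n f H Y hH hf hY hrel

end Table

section Rungs
variable {n : ℕ}

/-- **RUNG R1 (decided, all primes) — the finite-range end of the CONTINENT dial on piece I.**
If `Y` is an exchangeable block with `|Y| ≥ p − 1` and at most the coordinates of `K` are relevant outside `Y`
(the «continent» is a `K`-junta), then `f` has the normal form with junta bound `|K|`: the block enters through
ONE linear form (the tree's `SubChar.jBlock_frob_law` at `m = 1`).  The open content of `IslandAt p` is exactly the
UNIFORMITY of the junta bound in the size of the continent (probe P15: this rung does not give `IslandAt p`). -/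
theorem island_small_continent (p : ℕ) [Fact p.Prime] (f : (Fin n → Bool) → Bool) (Y K : Finset (Fin n))
    (hf : HasDegF p f (p - 1)) (hY : p - 1 ≤ Y.card) (hex : Exch f Y)
    (hK : ∀ i, i ∉ Y → i ∉ K → ¬ Relevant f i) : NormalForm p f K.card := by
  classical
  -- irrelevance outside `Y ∪ K`, as update-invariance
  have hirr : ∀ u, ∀ k ∈ Finset.univ \ (Y ∪ K), ∀ b, f (Function.update u k b) = f u := by
    intro u k hk b
    have hk' : k ∉ Y ∪ K := (Finset.mem_sdiff.1 hk).2
    by_contra hne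
    exact hK k (fun h => hk' (Finset.mem_union_left _ h)) (fun h => hk' (Finset.mem_union_right _ h)) ⟨u, b, hne⟩
  -- `f` is a function of `(u|_{K \ Y}, bw_Y u)`
  have hsym : ∀ u v : Fin n → Bool, (∀ i ∈ K \ Y, u i = v i) → (∀ j : Fin 1, SubChar.bw Y u = SubChar.bw Y v) →
      f u = f v := by
    intro u v hJ hbw
    let w : Fin n → Bool := fun i => if i ∈ Y then u i else v i
    have huw : f u = f w := by
      refine SubChar.agree_of_irrelevant f (Finset.univ \ (Y ∪ K)) hirr u w (fun k hk => ?_)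
      have hkYK : k ∈ Y ∪ K := by
        by_contra h
        exact hk (Finset.mem_sdiff.2 ⟨Finset.mem_univ _, h⟩)
      by_cases hkY : k ∈ Y
      · simp [w, hkY]
      · have hkK : k ∈ K := (Finset.mem_union.1 hkYK).resolve_left hkY
        have : u k = v k := hJ k (Finset.mem_sdiff.2 ⟨hkK, hkY⟩)
        simp [w, hkY, this]
    have hwv : f w = f v := by
      refine SubChar.symm_of_swap_invariant f (fun u i hi j hj => hex i hi j hj u) w v (fun k hk => ?_) ?_
      · simp [w, hk]
      · have hbwY : SubChar.bw Y w = SubChar.bw Y u := by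
          unfold SubChar.bw
          congr 1
          ext i
          simp only [Finset.mem_filter, w]
          constructor
          · rintro ⟨hi, h⟩; exact ⟨hi, by simpa [hi] using h⟩
          · rintro ⟨hi, h⟩; exact ⟨hi, by simpa [hi] using h⟩
        rw [hbwY]
        exact hbw 0
    exact huw.trans hwv
  obtain ⟨c, h, hh⟩ := SubChar.jBlock_frob_law p (m := 1) (fun _ => Y)
    (fun j k hjk => absurd (Subsingleton.elim j k) hjk) (fun _ => hY) (K \ Y)
    (fun _ => disjoint_sdiff_self_left) f hsym hf
  refine ⟨K \ Y, Finset.card_le_card Finset.sdiff_subset, c, fun u s => h (JLin.proj (K \ Y) u) s, ?_, fun u => hh u⟩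
  intro u v huv s
  show h (JLin.proj (K \ Y) u) s = h (JLin.proj (K \ Y) v) s
  congr 1
  funext i
  unfold JLin.proj
  by_cases hi : i ∈ K \ Y
  · rw [if_pos hi, if_pos hi, huv i hi]
  · rw [if_neg hi, if_neg hi]

/-- R1 in piece form: the continent dial at every finite setting `k` is DECIDED with junta bound `k`
(`IslandAt p` asks for a bound independent of `k`). -/
theorem islandAt_fin (p : ℕ) [Fact p.Prime] (k : ℕ) :
    ∀ (n : ℕ) (f : (Fin n → Bool) → Bool) (Y : Finset (Fin n)), HasDegF p f (p - 1) → p ≤ Y.card → Exch f Y →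
      (∃ K : Finset (Fin n), K.card ≤ k ∧ ∀ i, i ∉ Y → Relevant f i → i ∈ K) → NormalForm p f k := by
  intro n f Y hf hY hex ⟨K, hKk, hK⟩
  have hp1 : p - 1 ≤ Y.card := le_trans (Nat.sub_le p 1) hY
  obtain ⟨J, hJ, a, h, hh, hf'⟩ := island_small_continent p f Y K hf hp1 hex
    (fun i hiY hiK hrel => hiK (hK i hiY hrel))
  exact ⟨J, hJ.trans hKk, a, h, hh, hf'⟩

/-- **RUNG R0 (decided, all primes) — the island is the whole cube.**  A fully exchangeable `f` of degree `≤ p − 1`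
on `n ≥ p − 1` coordinates is a function of the weight mod `p` (normal form with EMPTY junta); by name from the
tree's `SubChar.symmetric_frob` route this is lens-6's symmetric sector, here read off R1 with `K = ∅`. -/
theorem island_whole (p : ℕ) [Fact p.Prime] (f : (Fin n → Bool) → Bool) (hf : HasDegF p f (p - 1))
    (hn : p - 1 ≤ n) (hex : Exch f Finset.univ) : NormalForm p f 0 := by
  have h := island_small_continent p f Finset.univ ∅ hf (by simpa using hn) hex
    (fun i hi _ => absurd (Finset.mem_univ i) hi)
  simpa using h

end Rungs

/-- The node read through the table layer: `ExchCoreOdd → (∀ p ≥ 5, TableAt p) → T`. -/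
theorem closes_table (hE : ExchCoreOdd) (hTab : ∀ (p : ℕ) [Fact p.Prime], 5 ≤ p → TableAt p) :
    Summit.QuantumAdvantage.QuantumAdvantage.Theses.CharDial.FrobStructureLawOdd :=
  closes hE fun p _ hp => (islandAt_iff_tableAt p).2 (hTab p hp)


end Summit.QuantumAdvantage.QuantumAdvantage.Theorems.IslandDial
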